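import Literature.NumberTheory.Sieve.MoebiusExpSumDavenport

/-!
# Route `GreenTaoLevelTwo`, crux `MNTwo` (stmt-Parity-21276), line `birth`, stub `stub_mnVertical`:
# Fourier coefficients of Möbius on a dyadic block and a residue class, read in `ℤ/pℤ` (GT 2008b Prop. 15)

Brick for block V2 of the `stub_mnVertical` census (B. Green, T. Tao, *Quadratic uniformity of the
Möbius function*, Ann. Inst. Fourier 58 (2008) = arXiv:math/0606087, §6, proof of Prop. 15: "We work in
the group `ℤ/pℤ` … `μ̃(x) := μ(x)1_{N < x ≤ 2N}` … from (mu-alpha) we have `μ̃^(ξ) ≪_A log^{−A} N` for any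
`ξ`" — with the residue class `1_{X_s}` included, i.e. Davenport on progressions).  This is the input `D`
of `…MNTwoDualApproximation.norm_sum_le_of_approx_dual`.  Def-free:

* `stdAddChar_natCast_mul` — `e_p(n ξ) = e(n · val(ξ)/p)` for `n ∈ ℕ`;
* `sum_fiber_eq_sum` — `Σ_{x ∈ ℤ/pℤ} (Σ_{n ∈ S, n ≡ x} g n) G x = Σ_{n ∈ S} g n G n`;
* `norm_sum_moebius_block_progression_le` — for every `A > 0` there is `C` with
  `‖Σ_{N < n ≤ 2N, n ≡ r (q)} μ(n) e_p(n ξ)‖ ≤ C N / log^A N` for all `N ≥ 2`, `p`, `q ≥ 1`, `r`, `ξ`.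

References: [GreenTao2008QuadraticMobius] arXiv:math/0606087 §6, proof of Proposition 15; Davenport (tree:
`MoebiusDavenport.davenport_progression`).
-/

noncomputable section

open Finset Real ArithmeticFunction
open scoped FourierTransform ArithmeticFunction.Moebius

namespace Summit.Parity.GeneralizedHardyLittlewood.GreenTaoLevelTwoMNTwoMoebiusTransfer

open Literature.NumberTheory.Sieve.MoebiusDavenport (davenport_progression)

/-- `e_p(n ξ) = e(n · val(ξ)/p)` for natural `n`. [folklore] -/
theorem stdAddChar_natCast_mul {p : ℕ} [NeZero p] (n : ℕ) (ξ : ZMod p) :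
    (ZMod.stdAddChar ((n : ZMod p) * ξ) : ℂ) = (𝐞 ((n : ℝ) * ((ξ.val : ℝ) / p)) : ℂ) := by
  have e1 : (n : ZMod p) * ξ = (((n * ξ.val : ℕ) : ℤ) : ZMod p) := by
    push_cast; rw [ZMod.natCast_zmod_val]
  rw [e1, ZMod.stdAddChar_coe, Real.fourierChar_apply]
  congr 1
  push_cast
  ring

/-- Reading a sum over `S ⊆ ℕ` as a sum over `ℤ/pℤ` of the fibre sums. [folklore] -/
theorem sum_fiber_eq_sum {p : ℕ} [NeZero p] (S : Finset ℕ) (g : ℕ → ℂ) (G : ZMod p → ℂ) :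
    ∑ x : ZMod p, (∑ n ∈ S.filter (fun n : ℕ => ((n : ℕ) : ZMod p) = x), g n) * G x =
      ∑ n ∈ S, g n * G (n : ZMod p) := by
  classical
  rw [← Finset.sum_fiberwise_of_maps_to (s := S) (t := (Finset.univ : Finset (ZMod p)))
    (g := fun n : ℕ => (n : ZMod p)) (fun n _ => mem_univ _)]
  refine Finset.sum_congr rfl fun x _ => ?_
  rw [Finset.sum_mul]
  refine Finset.sum_congr rfl fun n hn => ?_
  rw [mem_filter] at hn
  rw [hn.2]

/-- **Fourier coefficients of Möbius on a dyadic block and a residue class (GT 2008b, proof of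
Prop. 15).**  For every `A > 0` there is `C` such that for all `N ≥ 2`, all `p ≥ 1`, all `q ≥ 1`, `r`,
and every `ξ ∈ ℤ/pℤ`: `‖Σ_{N < n ≤ 2N, n ≡ r (q)} μ(n) e_p(nξ)‖ ≤ C N / log^A N`.
[cite: GreenTao2008QuadraticMobius, proof of Proposition 15] -/
theorem norm_sum_moebius_block_progression_le {A : ℝ} (hA : 0 < A) :
    ∃ C : ℝ, ∀ N : ℕ, 2 ≤ N → ∀ (p : ℕ) [NeZero p], ∀ q : ℕ, 1 ≤ q → ∀ r : ℕ, ∀ ξ : ZMod p,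
      ‖∑ n ∈ (Ioc N (2 * N)).filter (fun n : ℕ => n % q = r),
          ((μ n : ℝ) : ℂ) * (ZMod.stdAddChar ((n : ZMod p) * ξ) : ℂ)‖ ≤ C * N / Real.log N ^ A := by
  obtain ⟨C, hC⟩ := davenport_progression A hA
  refine ⟨3 * max C 0, fun N hN p _ q hq r ξ => ?_⟩
  have hNpos : (0 : ℝ) < N := by exact_mod_cast (show 0 < N by omega)
  have hlog : 0 < Real.log N := Real.log_pos (by exact_mod_cast (show 1 < N by omega))
  have hLA : 0 < Real.log N ^ A := Real.rpow_pos_of_pos hlog A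
  set α : ℝ := (ξ.val : ℝ) / p with hα
  -- rewrite with real characters and split `(N, 2N] = [1, 2N] \\ [1, N]`
  have hchar : ∀ n : ℕ, (ZMod.stdAddChar ((n : ZMod p) * ξ) : ℂ) = (𝐞 ((n : ℝ) * α) : ℂ) :=
    fun n => stdAddChar_natCast_mul n ξ
  simp_rw [hchar]
  have hsplit : (Ioc N (2 * N)).filter (fun n : ℕ => n % q = r) =
      (Icc 1 (2 * N)).filter (fun n : ℕ => n % q = r) \ (Icc 1 N).filter (fun n : ℕ => n % q = r) := by
    ext n
    simp only [mem_filter, mem_Ioc, mem_Icc, mem_sdiff]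
    constructor
    · rintro ⟨⟨h1, h2⟩, h3⟩; exact ⟨⟨⟨by omega, h2⟩, h3⟩, fun h => by omega⟩
    · rintro ⟨⟨⟨h1, h2⟩, h3⟩, h4⟩
      refine ⟨⟨?_, h2⟩, h3⟩
      by_contra h5
      exact h4 ⟨⟨h1, by omega⟩, h3⟩
  have hsub : (Icc 1 N).filter (fun n : ℕ => n % q = r) ⊆ (Icc 1 (2 * N)).filter (fun n : ℕ => n % q = r) := by
    intro n hn
    rw [mem_filter, mem_Icc] at hn ⊢
    exact ⟨⟨hn.1.1, by omega⟩, hn.2⟩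
  rw [hsplit, Finset.sum_sdiff_eq_sub hsub]
  have h2N : 2 ≤ 2 * N := by omega
  have hb1 := hC (2 * N) h2N q hq r α
  have hb2 := hC N hN q hq r α
  -- compare the two Davenport bounds with `3 max(C,0) N / log^A N`
  have hlog2 : Real.log N ≤ Real.log ((2 * N : ℕ) : ℝ) := by
    apply Real.log_le_log hNpos; push_cast; linarith
  have hLA2 : Real.log N ^ A ≤ Real.log ((2 * N : ℕ) : ℝ) ^ A :=
    Real.rpow_le_rpow hlog.le hlog2 hA.le
  have hb1' : C * ((2 * N : ℕ) : ℝ) / Real.log ((2 * N : ℕ) : ℝ) ^ A ≤ 2 * max C 0 * N / Real.log N ^ A := by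
    have h1 : C * ((2 * N : ℕ) : ℝ) ≤ max C 0 * ((2 * N : ℕ) : ℝ) :=
      mul_le_mul_of_nonneg_right (le_max_left _ _) (Nat.cast_nonneg _)
    calc C * ((2 * N : ℕ) : ℝ) / Real.log ((2 * N : ℕ) : ℝ) ^ A
        ≤ max C 0 * ((2 * N : ℕ) : ℝ) / Real.log ((2 * N : ℕ) : ℝ) ^ A :=
          div_le_div_of_nonneg_right h1 (hLA.le.trans hLA2)
      _ ≤ max C 0 * ((2 * N : ℕ) : ℝ) / Real.log N ^ A :=
          div_le_div_of_nonneg_left (by positivity) hLA hLA2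
      _ = 2 * max C 0 * N / Real.log N ^ A := by push_cast; ring
  have hb2' : C * N / Real.log N ^ A ≤ max C 0 * N / Real.log N ^ A := by
    rw [div_le_div_iff_of_pos_right hLA]
    exact mul_le_mul_of_nonneg_right (le_max_left _ _) hNpos.le
  calc ‖∑ n ∈ (Icc 1 (2 * N)).filter (fun n : ℕ => n % q = r), ((μ n : ℝ) : ℂ) * (𝐞 ((n : ℝ) * α) : ℂ) -
        ∑ n ∈ (Icc 1 N).filter (fun n : ℕ => n % q = r), ((μ n : ℝ) : ℂ) * (𝐞 ((n : ℝ) * α) : ℂ)‖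
      ≤ ‖∑ n ∈ (Icc 1 (2 * N)).filter (fun n : ℕ => n % q = r), ((μ n : ℝ) : ℂ) * (𝐞 ((n : ℝ) * α) : ℂ)‖ +
        ‖∑ n ∈ (Icc 1 N).filter (fun n : ℕ => n % q = r), ((μ n : ℝ) : ℂ) * (𝐞 ((n : ℝ) * α) : ℂ)‖ :=
          norm_sub_le _ _
    _ ≤ 2 * max C 0 * N / Real.log N ^ A + max C 0 * N / Real.log N ^ A :=
        add_le_add (hb1.trans hb1') (hb2.trans hb2')
    _ = 3 * max C 0 * N / Real.log N ^ A := by ring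

end Summit.Parity.GeneralizedHardyLittlewood.GreenTaoLevelTwoMNTwoMoebiusTransfer
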